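import Mathlib
import Summits.KontsevichZagierPeriods.Zeta5Search.CasoratianClassBoundProof
import Summits.KontsevichZagierPeriods.Zeta5Search.RecordFamilyCertificates
import HarnessLib

/-!
# ζ(5) search — Brown–Zudilin's Sect. 12 direction: the "missing unit" cell `18n < p ≤ 19n` is the Casoratian class law (HONEST FRAMING: systematic search; no irrationality claim unless certified)

Cell `pub-zeta5`, family designer `fam-rv` generation 7 (`families/rv/FAMILY.md` §17.8; gen-8 starter file).  Brown–Zudilin
[BrownZudilin2022, Sect. 12] observe for `a = (15,20,16,14,18,17,16,20)` (dual ray `b(n) = n·(50; 15,20,14,18,16,17,17)`, `d = 33n`)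
that their permutation-group accounting (28)–(30) gives `ν_p = 3` on `n/p ∈ [1/19, 1/18)` while experimentally the exponent is `4`
(`γ`: `0.85163139…` vs `0.85665016…`).  FAMILY §17.8 locates the unit: on that cell the tree's CLASS BOUND `casLB` (THEOREM LB,
`casoratianClassBound_holds`) equals `−4` while the `S₇`-gauge accounting only certifies `v_p(Cas₃) ≥ −5`; `P = ρ·Cas₃`
(`RVFlatGauge.POf_eq`) with `v_p ρ = 3` turns `−4` into BZ's experimental exponent.  This file types the ray and the cell statement:

* `bSect12 n`, `bSect12_eq_bOfA` (it IS `b(n·sect12Vec)`), `inPolytope_bSect12`, `inPolytope_shift_bSect12`;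
* `Sect12ClassValue` — the class-bound VALUE on the cell, `casLB (bSect12 n) p = −4` for `18n < p ≤ 19n` (a decidable computation for each
  `(n,p)`: KERNEL-EVALUATED below for every cell prime with `n ≤ 6` (`classValue_*`, `sect12ClassValue_le_six`); checked for all `n ≤ 150`,
  1,525 primes, by the literal port `code/census/g22/ladder.mbounds_lean`; the all-`n` proof is the atlas machine's business, as for `RecordAtlas`);
* `sect12Cell_of_classValue` — **`v_p(Cas_j(b(n))) ≥ −4` on the cell** for all `n`, from THEOREM LB and `Sect12ClassValue` (the window `50n + 2 < p²`
  is automatic); `sect12Cell_le_six` — the same UNCONDITIONALLY for `1 ≤ n ≤ 6` (Brown–Zudilin's experimental exponent at the first cell primes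
  `19, 37, 73, 109, 113` is a kernel-checked theorem).
Valuations of rational numbers; nothing about irrationality.
-/

open Finset

namespace Summit.KontsevichZagierPeriods.Zeta5Search.RVSect12

open Summit.KontsevichZagierPeriods.Zeta5Search.CasoratianValuation (InPolytope shift casoratian)
open Summit.KontsevichZagierPeriods.Zeta5Search.ClusterValuation (casLB CasoratianClassBound casoratianClassBound_holds)
open Literature.NumberTheory.Irrationality.BrownZudilin2022 (bOfA)
open Summit.KontsevichZagierPeriods.Zeta5Search.WedgeDictionary (bOfA_nsmul)
open Summit.KontsevichZagierPeriods.Zeta5Search.Sect12Family (sect12Vec)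

/-- The Sect. 12 dual ray `b(n) = n·(50; 15,20,14,18,16,17,17)` (`d = 33n`, `m₁ = 21n`, `m₅ = 19n`; in-cone). -/
def bSect12 (n : ℕ) : ℕ → ℤ := fun i => (n : ℤ) * (([50, 15, 20, 14, 18, 16, 17, 17] : List ℤ).getD i 0)

/-- `bSect12 n` IS the dual parameter vector `b(n·a)` of `n` times Brown–Zudilin's Sect. 12 direction `a = sect12Vec`. -/
theorem bSect12_eq_bOfA (n : ℕ) : bOfA (fun i => (n : ℤ) * sect12Vec i) = bSect12 n := by
  funext j
  rw [bOfA_nsmul]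
  match j with
  | 0 => have h : bOfA sect12Vec 0 = 50 := by decide
         simp [h, bSect12]
  | 1 => have h : bOfA sect12Vec 1 = 15 := by decide
         simp [h, bSect12]
  | 2 => have h : bOfA sect12Vec 2 = 20 := by decide
         simp [h, bSect12]
  | 3 => have h : bOfA sect12Vec 3 = 14 := by decide
         simp [h, bSect12]
  | 4 => have h : bOfA sect12Vec 4 = 18 := by decide
         simp [h, bSect12]
  | 5 => have h : bOfA sect12Vec 5 = 16 := by decide
         simp [h, bSect12]
  | 6 => have h : bOfA sect12Vec 6 = 17 := by decide
         simp [h, bSect12]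
  | 7 => have h : bOfA sect12Vec 7 = 17 := by decide
         simp [h, bSect12]
  | k + 8 => simp [bOfA, bSect12]

/-- The Sect. 12 ray lies in the polytope. -/
theorem inPolytope_bSect12 (n : ℕ) : InPolytope (bSect12 n) := by
  refine ⟨⟨?_, ?_⟩, ?_, ?_⟩
  · simp [bSect12]
  · intro j hj
    simp only [Finset.mem_range] at hj
    interval_cases j <;> simp [bSect12] <;> omega
  · intro i hi
    simp only [Finset.mem_range] at hi
    interval_cases i <;> simp [bSect12] <;> omega
  · simp [bSect12, Finset.sum_range_succ]; omega

/-- Its contiguous shifts stay in the polytope (`n ≥ 1`). -/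
theorem inPolytope_shift_bSect12 (n j : ℕ) (hn : 1 ≤ n) (hj1 : 1 ≤ j) (hj7 : j ≤ 7) : InPolytope (shift (bSect12 n) j) := by
  interval_cases j <;>
  · refine ⟨⟨?_, ?_⟩, ?_, ?_⟩
    · simp [shift, bSect12]
    · intro i hi
      simp only [Finset.mem_range] at hi
      interval_cases i <;> simp [shift, bSect12, Function.update] <;> omega
    · intro i hi
      simp only [Finset.mem_range] at hi
      interval_cases i <;> simp [shift, bSect12, Function.update] <;> omega
    · simp [shift, bSect12, Function.update, Finset.sum_range_succ]; omega

/-- **THE CLASS-BOUND VALUE ON THE SECT. 12 CELL** (FAMILY §17.8 (a); a decidable computation for each `(n,p)`, checked for all `n ≤ 150`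
(1,525 primes, all `−4`); to be discharged for all `n` by the atlas machine): `casLB(b(n), p) = −4` for `18n < p ≤ 19n`. -/
@[conjecture] def Sect12ClassValue : Prop :=
  ∀ (n p : ℕ), 1 ≤ n → p.Prime → 18 * n < p → p ≤ 19 * n → casLB (bSect12 n) p = -4

/-- The THEOREM-LB window holds on (and far beyond) the cell: `50n + 2 < p²` once `18n < p`, `n ≥ 1`. -/
theorem window_bSect12 (n p : ℕ) (hn : 1 ≤ n) (hpn : 18 * n < p) : (bSect12 n 0 + 2 : ℤ) < (p : ℤ) ^ 2 := by
  have key : 50 * n + 2 < p * p := by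
    have hP : 19 ≤ p := by omega
    have hpp : 19 * p ≤ p * p := Nat.mul_le_mul_right p hP
    omega
  have h0 : bSect12 n 0 = (50 * n : ℕ) := by simp [bSect12]; ring
  rw [h0]; push_cast; nlinarith [key]

/-- **THE SECT. 12 CELL, relative to the class-bound value**: `v_p(Cas_j(b(n))) ≥ −4` for every `j` and every prime `18n < p ≤ 19n`
(THEOREM LB `casoratianClassBound_holds` + `Sect12ClassValue`).  With `v_p ρ(b(n)) = 3` there (four `E`-pair forms and `d` in `[p, 2p)`,
no denominator single `≥ p`) this is Brown–Zudilin's experimental exponent `4` = `v_p(P_n) ≥ −1`, one beyond (28)–(30). -/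
theorem sect12Cell_of_classValue (hV : Sect12ClassValue) (n j p : ℕ) (hn : 1 ≤ n) (hj1 : 1 ≤ j) (hj7 : j ≤ 7) (hp : p.Prime)
    (hlo : 18 * n < p) (hhi : p ≤ 19 * n) (hcas : casoratian (bSect12 n) j ≠ 0) :
    (-4 : ℤ) ≤ padicValRat p (casoratian (bSect12 n) j) := by
  have h5 : 5 ≤ p := by omega
  have hLB := casoratianClassBound_holds (bSect12 n) j p (inPolytope_bSect12 n) hj1 hj7 (inPolytope_shift_bSect12 n j hn hj1 hj7) hp h5
    (window_bSect12 n p hn hlo) hcas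
  rw [hV n p hn hp hlo hhi] at hLB
  exact hLB

/-! ### Kernel evaluation of the class-bound value at the cell primes with `n ≤ 6` (`decide +kernel`; `p ∈ {19, 37, 73, 109, 113}` —
for `n = 3, 5` the cell `(18n, 19n]` contains no prime) -/

set_option maxRecDepth 100000 in
/-- `casLB(b(1), 19) = −4`. -/
theorem classValue_one : casLB (bSect12 1) 19 = -4 := by decide +kernel

set_option maxRecDepth 100000 in
/-- `casLB(b(2), 37) = −4`. -/
theorem classValue_two : casLB (bSect12 2) 37 = -4 := by decide +kernel

set_option maxRecDepth 100000 in
/-- `casLB(b(4), 73) = −4`. -/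
theorem classValue_four : casLB (bSect12 4) 73 = -4 := by decide +kernel

set_option maxRecDepth 100000 in
/-- `casLB(b(6), 109) = −4`. -/
theorem classValue_six : casLB (bSect12 6) 109 = -4 := by decide +kernel

set_option maxRecDepth 100000 in
/-- `casLB(b(6), 113) = −4`. -/
theorem classValue_six' : casLB (bSect12 6) 113 = -4 := by decide +kernel

/-- **`Sect12ClassValue` for `n ≤ 6` is a THEOREM** (the five kernel evaluations above; no prime in the cell for `n = 3, 5`). -/
theorem sect12ClassValue_le_six (n p : ℕ) (hn : 1 ≤ n) (h6 : n ≤ 6) (hp : p.Prime) (hlo : 18 * n < p) (hhi : p ≤ 19 * n) :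
    casLB (bSect12 n) p = -4 := by
  interval_cases n
  · obtain rfl : p = 19 := by omega
    exact classValue_one
  · rcases (by omega : p = 37 ∨ p = 38) with rfl | rfl
    · exact classValue_two
    · exact absurd hp (by norm_num)
  · rcases (by omega : p = 55 ∨ p = 56 ∨ p = 57) with rfl | rfl | rfl <;> exact absurd hp (by norm_num)
  · rcases (by omega : p = 73 ∨ p = 74 ∨ p = 75 ∨ p = 76) with rfl | rfl | rfl | rfl
    · exact classValue_four
    all_goals exact absurd hp (by norm_num)
  · rcases (by omega : p = 91 ∨ p = 92 ∨ p = 93 ∨ p = 94 ∨ p = 95) with rfl | rfl | rfl | rfl | rfl <;> exact absurd hp (by norm_num)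
  · rcases (by omega : p = 109 ∨ p = 110 ∨ p = 111 ∨ p = 112 ∨ p = 113 ∨ p = 114) with rfl | rfl | rfl | rfl | rfl | rfl
    · exact classValue_six
    · exact absurd hp (by norm_num)
    · exact absurd hp (by norm_num)
    · exact absurd hp (by norm_num)
    · exact classValue_six'
    · exact absurd hp (by norm_num)

/-- **BROWN–ZUDILIN'S SECT. 12 EXPONENT `4` IS A THEOREM FOR `n ≤ 6`**: `v_p(Cas_j(b(n))) ≥ −4` for every `j` and every prime of the cell
`18n < p ≤ 19n`, `1 ≤ n ≤ 6` — unconditionally (THEOREM LB + the kernel-evaluated class-bound values).  The `S₇`-gauge accounting (28)–(30)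
certifies only `−5` here (FAMILY §17.8 (a)). -/
theorem sect12Cell_le_six (n j p : ℕ) (hn : 1 ≤ n) (h6 : n ≤ 6) (hj1 : 1 ≤ j) (hj7 : j ≤ 7) (hp : p.Prime)
    (hlo : 18 * n < p) (hhi : p ≤ 19 * n) (hcas : casoratian (bSect12 n) j ≠ 0) :
    (-4 : ℤ) ≤ padicValRat p (casoratian (bSect12 n) j) := by
  have h5 : 5 ≤ p := by omega
  have hLB := casoratianClassBound_holds (bSect12 n) j p (inPolytope_bSect12 n) hj1 hj7 (inPolytope_shift_bSect12 n j hn hj1 hj7) hp h5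
    (window_bSect12 n p hn hlo) hcas
  rw [sect12ClassValue_le_six n p hn h6 hp hlo hhi] at hLB
  exact hLB

end Summit.KontsevichZagierPeriods.Zeta5Search.RVSect12
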